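import Mathlib
import HarnessLib
import Summits.Ventures.LatticeQCDFlow.Scoring.MarkovChainCLT
import Summits.Ventures.LatticeQCDFlow.Scoring.ChainEmpiricalProcessIncrement
import Summits.Ventures.LatticeQCDFlow.Scoring.AsymptoticCoverage
import Summits.Ventures.LatticeQCDFlow.Scoring.CdfConvergence

/-!
# THE SAMPLE-QUANTILE CENTRAL LIMIT THEOREM FOR MARKOV-CHAIN OUTPUT, from any start: for a
# Doeblin chain and a statistic `O` whose stationary distribution function has a derivative `f`
# at its `u`-quantile `q`, `√N (q̂_N − q) ⇒ N(0, σ_q²/f²)` with `σ_q²` the Green–Kubo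
# (integrated-autocorrelation) variance of the indicator `1{O ≤ q}`

HONEST FRAMING: exact (Metropolis-corrected) sampling algorithms for lattice gauge theory;
figures of merit are autocorrelation/cost numbers at stated couplings and volumes; no
continuum-physics claim.

Venture `LatticeQCDFlow` (cell pub-lqcd), topic `Scoring`; FANOUT row 4 (`s0-u1-b`, rung S0-B).
Medians and percentiles printed from ONE Markov-chain run need the `τ_int`-corrected error bar
`σ_q/(f(q)√N)`, `σ_q² = Var_π 1{O ≤ q} + 2 Σ_{k≥1} Cov_π(1{O(X_0) ≤ q}, 1{O(X_k) ≤ q})`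
(Doss–Flegal–Jones–Neath 2014, NAMED ONLY; nothing is cited as a fact).  **ABSTRACT CORE**
(`sampleQuantile_clt_cdf_of_edf_clt`, `sampleQuantile_clt_of_edf_clt`): any chain with invariant
`π`, `κ(x, ·) ≥ ε π`, whose empirical distribution function obeys a CLT AT THE POINT `q`
(`(√N)⁻¹ Σ_{i<N} (1{O(X_i) ≤ q} − u) ⇒ Y ∼ N(0, v)`, `v ≠ 0`) satisfies
`P_{μ₀}(√N (q̂_N − q) ≤ x) → N(0, v)((−∞, x·f])` for every `x` and, for `f > 0`,
`√N (q̂_N − q) ⇒ Y/f ∼ N(0, v/f²)`; ingredients: the moving-point step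
`ChainEmpiricalProcessIncrement.chain_edfIncrement_tendstoInMeasure`, the Galois connection of
the empirical quantile (`QuantileBand`), Slutsky (`TendstoInDistribution.add_of_tendstoInMeasure_
const`), the portmanteau theorem at the continuity set `[−x·f, ∞)` (`AsymptoticCoverage`), the
symmetry of the centred Gaussian, the converse packaging `CdfConvergence.tendstoInDistribution_of_
tendsto_cdf` and the measurability of the empirical quantile (`measurable_edfQuantile`).
**DOEBLIN CHAIN** (`chain_sampleQuantile_clt`): row 8's any-start
`MarkovChainCLT.markovChain_clt` for the indicator (minorisation halved to meet its `ε < 1`)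
discharges the EDF CLT, with `v = σ_q²` the Green–Kubo variance.  NEW WORK of the cell (our
formalisation); no definition is introduced.

## Content

* `measurable_edfQuantile`;
* **`sampleQuantile_clt_cdf_of_edf_clt`** (cdf form, abstract);
* **`sampleQuantile_clt_of_edf_clt`** (`TendstoInDistribution` form, abstract),
  **`chain_sampleQuantile_clt`** (Doeblin chain, any start; its cdf form is the abstract theorem fed
  the same way).

NOT CLAIMED: the degenerate case `σ_q² = 0`; a consistent estimator of `σ_q²` from the chain and
hence a studentised interval (the estimator-free band-inversion bracket is
`Scoring/ChainEDFConfidenceBand`); a rate.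
-/

noncomputable section

namespace Summit.Ventures.LatticeQCDFlow.Scoring.GlivenkoCantelli

open MeasureTheory ProbabilityTheory Finset Filter Function
open scoped Topology ENNReal NNReal

variable {Ω : Type*} [MeasurableSpace Ω]

/-! ## §1 Measurability of the empirical quantile -/

section Measurability

/-- **The empirical `u`-quantile of the first `N` values of a measurable statistic along a path is
a measurable function of the path** (`u ∈ (0,1)`). [folklore] (`{Q ≤ b} = {u ≤ F̂_N(b)}` by the
Galois connection; `N = 0` gives a constant) -/
theorem measurable_edfQuantile {O : Ω → ℝ} (hO : Measurable O) {u : ℝ} (hu0 : 0 < u)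
    (hu1 : u < 1) (N : ℕ) :
    Measurable fun ξ : ℕ → Ω =>
      sInf {y | u ≤ (∑ i ∈ range N, (Set.Iic y).indicator (1 : ℝ → ℝ) (O (ξ i))) / N} := by
  have hind : ∀ (s : ℝ) (i : ℕ), Measurable fun ξ : ℕ → Ω =>
      (Set.Iic s).indicator (1 : ℝ → ℝ) (O (ξ i)) := fun s i =>
    (measurable_one.indicator measurableSet_Iic).comp (hO.comp (measurable_pi_apply i))
  rcases Nat.eq_zero_or_pos N with hN | hN
  · subst hN
    simp only [Finset.range_zero, Finset.sum_empty, Nat.cast_zero, div_zero]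
    exact measurable_const
  · have hN1 : 1 ≤ N := hN
    refine measurable_of_Iic fun b => ?_
    have hset : (fun ξ : ℕ → Ω =>
        sInf {y | u ≤ (∑ i ∈ range N, (Set.Iic y).indicator (1 : ℝ → ℝ) (O (ξ i))) / N})
          ⁻¹' Set.Iic b
        = {ξ | u ≤ (∑ i ∈ range N, (Set.Iic b).indicator (1 : ℝ → ℝ) (O (ξ i))) / N} := by
      ext ξ
      simp only [Set.mem_preimage, Set.mem_Iic, Set.mem_setOf_eq]
      haveI := isProbabilityMeasure_empiricalMeasure (fun i => O (ξ i)) hN1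
      obtain ⟨-, -, hgal⟩ :=
        cdf_quantile_spec (((N : ℝ≥0∞)⁻¹) • ∑ i ∈ range N, Measure.dirac (O (ξ i))) hu0 hu1
      have hset' : {y | u ≤ (∑ i ∈ range N, (Set.Iic y).indicator (1 : ℝ → ℝ) (O (ξ i))) / N}
          = {y | u ≤ cdf (((N : ℝ≥0∞)⁻¹) • ∑ i ∈ range N, Measure.dirac (O (ξ i))) y} := by
        ext y
        rw [Set.mem_setOf_eq, Set.mem_setOf_eq, cdf_empiricalMeasure (fun i => O (ξ i)) hN1 y]
      rw [hset', hgal b, cdf_empiricalMeasure (fun i => O (ξ i)) hN1 b]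
    rw [hset]
    exact measurableSet_le measurable_const
      ((Finset.measurable_sum _ fun i _ => hind b i).div_const _)

end Measurability

/-! ## §2 The sample-quantile CLT (distribution-function form) -/

section QuantileCLT

variable {κ : Kernel Ω Ω} [IsMarkovKernel κ] {μ₀ : Measure Ω} [IsProbabilityMeasure μ₀]
  {π : Measure Ω} [IsProbabilityMeasure π]
  {Ω' : Type*} [MeasurableSpace Ω'] {P' : Measure Ω'} [IsProbabilityMeasure P'] {Y : Ω' → ℝ}

/-- **THE SAMPLE-QUANTILE CLT FROM AN EDF CLT AT THE QUANTILE (abstract, any start).**  `π`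
invariant for `κ`, `κ(x, ·) ≥ ε π` (`ε > 0`); `O` measurable, `F_π = cdf (π ∘ O⁻¹)` with
`F_π(q) = u ∈ (0,1)` and derivative `f` at `q`; under the trajectory law `P_{μ₀}` the empirical
distribution function of the chain at `q` obeys a CLT, `(√N)⁻¹ Σ_{i<N} (1{O(X_i) ≤ q} − u) ⇒ Y`,
`Y ∼ N(0, v)`, `v ≠ 0`.  Then for every real `x`, with `q̂_N = inf{y : u ≤ #{i<N : O(X_i) ≤ y}/N}`,
`P_{μ₀}(√N·(q̂_N − q) ≤ x) → N(0, v)((−∞, x·f])`, i.e. `√N (q̂_N − q) ⇒ N(0, v/f²)` in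
distribution-function form. [ours] -/
theorem sampleQuantile_clt_cdf_of_edf_clt (hπ : Kernel.Invariant κ π) {ε : ℝ≥0∞}
    (hmin : ∀ x {B : Set Ω}, MeasurableSet B → ε * π B ≤ κ x B) (hε0 : 0 < ε)
    {O : Ω → ℝ} (hO : Measurable O) {u q f : ℝ} (hu0 : 0 < u) (hu1 : u < 1)
    (hFq : cdf (π.map O) q = u) (hder : HasDerivAt (cdf (π.map O)) f q) {v : ℝ≥0} (hv : v ≠ 0)
    (hY : HasLaw Y (gaussianReal 0 v) P')
    [IsProbabilityMeasure (Kernel.trajMeasure (X := fun _ : ℕ => Ω) μ₀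
          (fun m : ℕ => κ.comap (fun y : (i : ↥(Finset.Iic m)) → Ω => y ⟨m, Finset.mem_Iic.2 le_rfl⟩)
            (measurable_pi_apply _)))]
    (hclt : TendstoInDistribution (fun (N : ℕ) (ξ : ℕ → Ω) =>
        (Real.sqrt N)⁻¹ * ∑ i ∈ range N, ((Set.Iic q).indicator (1 : ℝ → ℝ) (O (ξ i)) - u))
      atTop Y (fun _ => Kernel.trajMeasure (X := fun _ : ℕ => Ω) μ₀
          (fun m : ℕ => κ.comap (fun y : (i : ↥(Finset.Iic m)) → Ω => y ⟨m, Finset.mem_Iic.2 le_rfl⟩)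
            (measurable_pi_apply _))) P') (x : ℝ) :
    Tendsto (fun N : ℕ => (Kernel.trajMeasure (X := fun _ : ℕ => Ω) μ₀
          (fun m : ℕ => κ.comap (fun y : (i : ↥(Finset.Iic m)) → Ω => y ⟨m, Finset.mem_Iic.2 le_rfl⟩)
            (measurable_pi_apply _))).real
        {ξ | Real.sqrt N * (sInf {y | u ≤
            (∑ i ∈ range N, (Set.Iic y).indicator (1 : ℝ → ℝ) (O (ξ i))) / N} - q) ≤ x})
      atTop (𝓝 ((gaussianReal 0 v).real (Set.Iic (x * f)))) := by
  set P := Kernel.trajMeasure (X := fun _ : ℕ => Ω) μ₀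
      (fun m : ℕ => κ.comap (fun y : (i : ↥(Finset.Iic m)) → Ω => y ⟨m, Finset.mem_Iic.2 le_rfl⟩)
        (measurable_pi_apply _)) with hP
  haveI : IsProbabilityMeasure (π.map O) := Measure.isProbabilityMeasure_map hO.aemeasurable
  set F := cdf (π.map O) with hF
  -- the moving point `q + x/√N` and the deterministic centring `a_N`
  set a : ℕ → ℝ := fun N => Real.sqrt N * (F (q + x / Real.sqrt N) - u) with hadef
  have hsqrt : Tendsto (fun N : ℕ => Real.sqrt N) atTop atTop :=
    Real.tendsto_sqrt_atTop.comp tendsto_natCast_atTop_atTop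
  have ht : Tendsto (fun N : ℕ => q + x / Real.sqrt N) atTop (𝓝 q) := by
    have h1 : Tendsto (fun N : ℕ => x / Real.sqrt N) atTop (𝓝 0) := hsqrt.const_div_atTop x
    simpa using h1.const_add q
  -- `a_N → x·f` (the derivative of `F` at `q` along `t_N`)
  have ha : Tendsto a atTop (𝓝 (x * f)) := by
    -- `F(t_N) − u = (t_N − q)·φ(t_N)` with the difference quotient `φ → f`
    have hslope := hder.tendsto_slope_zero
    -- along `h_N = x/√N` (eventually nonzero unless `x = 0`)
    by_cases hx : x = 0
    · have : a = fun N => 0 := by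
        funext N
        simp [hadef, hx, hFq]
      rw [this, hx, zero_mul]
      exact tendsto_const_nhds
    · have hne : ∀ᶠ N : ℕ in atTop, x / Real.sqrt N ≠ 0 := by
        filter_upwards [eventually_ge_atTop 1] with N hN
        have : 0 < Real.sqrt N := Real.sqrt_pos.2 (by exact_mod_cast hN)
        exact div_ne_zero hx this.ne'
      have hlim0 : Tendsto (fun N : ℕ => x / Real.sqrt N) atTop (𝓝[≠] 0) :=
        tendsto_nhdsWithin_iff.2 ⟨hsqrt.const_div_atTop x, hne⟩
      have hq := hslope.comp hlim0
      -- `(x/√N)⁻¹ (F(q + x/√N) − F q) → f`; multiply by `x`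
      have hkey : (fun N : ℕ => x * ((x / Real.sqrt N)⁻¹ • (F (q + x / Real.sqrt N) - F q)))
          = a := by
        funext N
        rw [smul_eq_mul, inv_div, ← mul_assoc, mul_div_assoc', mul_div_cancel_left₀ _ hx, hadef,
          hFq]
      have := hq.const_mul x
      simp only [Function.comp_def] at this
      rw [hkey] at this
      exact this
  -- the increment plus the centring error tends to zero in probability
  have hcont : ContinuousAt F q := hder.continuousAt
  have hD := chain_edfIncrement_tendstoInMeasure (μ₀ := μ₀) hπ hmin hε0 hO hcont ht
  beta_reduce at hD
  rw [← hP] at hD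
  have hd : Tendsto (fun N => a N - x * f) atTop (𝓝 0) := by
    simpa using ha.sub_const (x * f)
  have hV := tendstoInMeasure_add_of_tendsto_zero hD hd
  -- measurability of the statistics
  have hind : ∀ (s : ℝ) (i : ℕ), Measurable fun ξ : ℕ → Ω =>
      (Set.Iic s).indicator (1 : ℝ → ℝ) (O (ξ i)) := fun s i =>
    (measurable_one.indicator measurableSet_Iic).comp (hO.comp (measurable_pi_apply i))
  have hSm : ∀ (s : ℝ) (N : ℕ), Measurable fun ξ : ℕ → Ω =>
      (Real.sqrt N)⁻¹ * ∑ i ∈ range N, ((Set.Iic s).indicator (1 : ℝ → ℝ) (O (ξ i)) - F s) :=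
    fun s N => measurable_const.mul (Finset.measurable_sum _ fun i _ => (hind s i).sub_const _)
  have hVm : ∀ N : ℕ, AEMeasurable (fun ξ : ℕ → Ω =>
      (Real.sqrt N)⁻¹ * ∑ i ∈ range N, ((Set.Iic (q + x / Real.sqrt N)).indicator (1 : ℝ → ℝ)
          (O (ξ i)) - F (q + x / Real.sqrt N))
        - (Real.sqrt N)⁻¹ * ∑ i ∈ range N, ((Set.Iic q).indicator (1 : ℝ → ℝ) (O (ξ i)) - F q)
        + (a N - x * f)) P := fun N =>
    (((hSm (q + x / Real.sqrt N) N).sub (hSm q N)).add_const _).aemeasurable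
  -- Slutsky: `S_N(q) + V_N ⇒ Y + 0`
  rw [hF] at hFq
  have hclt' : TendstoInDistribution (fun (N : ℕ) (ξ : ℕ → Ω) =>
      (Real.sqrt N)⁻¹ * ∑ i ∈ range N, ((Set.Iic q).indicator (1 : ℝ → ℝ) (O (ξ i)) - F q))
      atTop Y (fun _ => P) P' := by
    rw [hFq]
    exact hclt
  have hU := hclt'.add_of_tendstoInMeasure_const hV hVm
  -- the event identity, for `N ≥ 1`
  have hevent : ∀ᶠ N : ℕ in atTop,
      P.real {ξ | Real.sqrt N * (sInf {y | u ≤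
          (∑ i ∈ range N, (Set.Iic y).indicator (1 : ℝ → ℝ) (O (ξ i))) / N} - q) ≤ x}
        = P.real ((fun ξ : ℕ → Ω =>
          (Real.sqrt N)⁻¹ * ∑ i ∈ range N, ((Set.Iic q).indicator (1 : ℝ → ℝ) (O (ξ i)) - F q)
          + ((Real.sqrt N)⁻¹ * ∑ i ∈ range N,
              ((Set.Iic (q + x / Real.sqrt N)).indicator (1 : ℝ → ℝ) (O (ξ i))
                - F (q + x / Real.sqrt N))
            - (Real.sqrt N)⁻¹ * ∑ i ∈ range N,
              ((Set.Iic q).indicator (1 : ℝ → ℝ) (O (ξ i)) - F q)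
            + (a N - x * f))) ⁻¹' Set.Ici (-(x * f))) := by
    filter_upwards [eventually_ge_atTop 1] with N hN1
    have hN : N ≠ 0 := by omega
    have hNpos : (0 : ℝ) < N := by exact_mod_cast hN1
    have hsq : 0 < Real.sqrt N := Real.sqrt_pos.2 hNpos
    congr 1
    ext ξ
    simp only [Set.mem_setOf_eq, Set.mem_preimage, Set.mem_Ici]
    -- Galois connection for the empirical quantile at level `u`
    haveI := isProbabilityMeasure_empiricalMeasure (fun i => O (ξ i)) hN1
    obtain ⟨-, -, hgal⟩ :=
      cdf_quantile_spec (((N : ℝ≥0∞)⁻¹) • ∑ i ∈ range N, Measure.dirac (O (ξ i))) hu0 hu1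
    have hset : {y | u ≤ (∑ i ∈ range N, (Set.Iic y).indicator (1 : ℝ → ℝ) (O (ξ i))) / N}
        = {y | u ≤ cdf (((N : ℝ≥0∞)⁻¹) • ∑ i ∈ range N, Measure.dirac (O (ξ i))) y} := by
      ext y
      rw [Set.mem_setOf_eq, Set.mem_setOf_eq, cdf_empiricalMeasure (fun i => O (ξ i)) hN1 y]
    have hQ : Real.sqrt N * (sInf {y | u ≤
          (∑ i ∈ range N, (Set.Iic y).indicator (1 : ℝ → ℝ) (O (ξ i))) / N} - q) ≤ x
        ↔ u ≤ (∑ i ∈ range N,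
            (Set.Iic (q + x / Real.sqrt N)).indicator (1 : ℝ → ℝ) (O (ξ i))) / N := by
      rw [hset, mul_comm, ← le_div_iff₀ hsq, sub_le_iff_le_add', hgal (q + x / Real.sqrt N),
        cdf_empiricalMeasure (fun i => O (ξ i)) hN1]
    rw [hQ]
    -- the algebra `S_N(t_N) + x f − a_N = √N (Ê_N(t_N) − u) + x f`
    have hre : (Real.sqrt N)⁻¹ * ∑ i ∈ range N, ((Set.Iic q).indicator (1 : ℝ → ℝ) (O (ξ i)) - F q)
        + ((Real.sqrt N)⁻¹ * ∑ i ∈ range N,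
            ((Set.Iic (q + x / Real.sqrt N)).indicator (1 : ℝ → ℝ) (O (ξ i))
              - F (q + x / Real.sqrt N))
          - (Real.sqrt N)⁻¹ * ∑ i ∈ range N,
            ((Set.Iic q).indicator (1 : ℝ → ℝ) (O (ξ i)) - F q) + (a N - x * f))
        = Real.sqrt N * ((∑ i ∈ range N,
            (Set.Iic (q + x / Real.sqrt N)).indicator (1 : ℝ → ℝ) (O (ξ i))) / N - u) - x * f := by
      rw [sqrt_inv_mul_sum_sub _ _ hN, sqrt_inv_mul_sum_sub _ _ hN, hadef]
      ring
    rw [hre]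
    constructor
    · intro h
      have : 0 ≤ Real.sqrt N * ((∑ i ∈ range N,
          (Set.Iic (q + x / Real.sqrt N)).indicator (1 : ℝ → ℝ) (O (ξ i))) / N - u) :=
        mul_nonneg hsq.le (by linarith)
      linarith
    · intro h
      have h' : 0 ≤ Real.sqrt N * ((∑ i ∈ range N,
          (Set.Iic (q + x / Real.sqrt N)).indicator (1 : ℝ → ℝ) (O (ξ i))) / N - u) := by linarith
      have := (mul_nonneg_iff_of_pos_left hsq).1 h'
      linarith
  -- portmanteau at the continuity set `[−x f, ∞)`
  have heY : (fun ω => Y ω + 0) = Y := funext fun ω => add_zero _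
  have hfr : (P'.map fun ω => Y ω + 0) (frontier (Set.Ici (-(x * f)))) = 0 := by
    rw [heY, hY.map_eq, frontier_Ici]
    haveI := nullSingletonClass_gaussianReal (μ := 0) hv
    exact (Set.countable_singleton _).measure_zero _
  have hlim := CardConsistency.tendsto_measureReal_preimage_of_tendstoInDistribution hU
    measurableSet_Ici hfr
  -- the limit: `P(Y ≥ −x f) = N(0, v)((−∞, x f])`
  have hval : P'.real ((fun ω => Y ω + 0) ⁻¹' Set.Ici (-(x * f)))
      = (gaussianReal 0 v).real (Set.Iic (x * f)) := by
    rw [heY, measureReal_def, measureReal_def, ← Measure.map_apply_of_aemeasurable hY.aemeasurable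
      measurableSet_Ici, hY.map_eq]
    congr 1
    have hneg : (gaussianReal 0 v).map (fun y => -y) = gaussianReal 0 v := by
      rw [gaussianReal_map_neg, neg_zero]
    conv_lhs => rw [← hneg]
    rw [Measure.map_apply measurable_neg measurableSet_Ici]
    congr 1
    ext y
    simp
  rw [hval] at hlim
  exact hlim.congr' (by filter_upwards [hevent] with N hN; exact hN.symm)

/-! ## §3 The `TendstoInDistribution` form -/

/-- **THE SAMPLE-QUANTILE CLT FROM AN EDF CLT AT THE QUANTILE, in distribution (abstract, any
start).**  Under the hypotheses of `sampleQuantile_clt_cdf_of_edf_clt` and `f > 0`: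
`√N (q̂_N − q) ⇒ Y/f`, where `Y ∼ N(0, v)` so that `Y/f ∼ N(0, v/f²)`
(`ProbabilityTheory.gaussianReal_div_const`). [ours] -/
theorem sampleQuantile_clt_of_edf_clt (hπ : Kernel.Invariant κ π) {ε : ℝ≥0∞}
    (hmin : ∀ x {B : Set Ω}, MeasurableSet B → ε * π B ≤ κ x B) (hε0 : 0 < ε)
    {O : Ω → ℝ} (hO : Measurable O) {u q f : ℝ} (hu0 : 0 < u) (hu1 : u < 1)
    (hFq : cdf (π.map O) q = u) (hder : HasDerivAt (cdf (π.map O)) f q) (hf : 0 < f) {v : ℝ≥0}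
    (hv : v ≠ 0) (hY : HasLaw Y (gaussianReal 0 v) P')
    [IsProbabilityMeasure (Kernel.trajMeasure (X := fun _ : ℕ => Ω) μ₀
          (fun m : ℕ => κ.comap (fun y : (i : ↥(Finset.Iic m)) → Ω => y ⟨m, Finset.mem_Iic.2 le_rfl⟩)
            (measurable_pi_apply _)))]
    (hclt : TendstoInDistribution (fun (N : ℕ) (ξ : ℕ → Ω) =>
        (Real.sqrt N)⁻¹ * ∑ i ∈ range N, ((Set.Iic q).indicator (1 : ℝ → ℝ) (O (ξ i)) - u))
      atTop Y (fun _ => Kernel.trajMeasure (X := fun _ : ℕ => Ω) μ₀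
          (fun m : ℕ => κ.comap (fun y : (i : ↥(Finset.Iic m)) → Ω => y ⟨m, Finset.mem_Iic.2 le_rfl⟩)
            (measurable_pi_apply _))) P') :
    TendstoInDistribution (fun (N : ℕ) (ξ : ℕ → Ω) =>
        Real.sqrt N * (sInf {y | u ≤
            (∑ i ∈ range N, (Set.Iic y).indicator (1 : ℝ → ℝ) (O (ξ i))) / N} - q))
      atTop (fun ω => Y ω / f) (fun _ => Kernel.trajMeasure (X := fun _ : ℕ => Ω) μ₀
          (fun m : ℕ => κ.comap (fun y : (i : ↥(Finset.Iic m)) → Ω => y ⟨m, Finset.mem_Iic.2 le_rfl⟩)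
            (measurable_pi_apply _))) P' := by
  refine CardConsistency.tendstoInDistribution_of_tendsto_cdf
    (fun N =>
      (measurable_const.mul ((measurable_edfQuantile hO hu0 hu1 N).sub_const q)).aemeasurable)
    (hY.aemeasurable.div_const f) fun x => ?_
  have h := sampleQuantile_clt_cdf_of_edf_clt (μ₀ := μ₀) hπ hmin hε0 hO hu0 hu1 hFq hder hv hY
    hclt x
  have e : P'.real {ω' | Y ω' / f ≤ x} = (gaussianReal 0 v).real (Set.Iic (x * f)) := by
    have hs : {ω' | Y ω' / f ≤ x} = Y ⁻¹' Set.Iic (x * f) := by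
      ext ω'
      simp only [Set.mem_setOf_eq, Set.mem_preimage, Set.mem_Iic]
      exact div_le_iff₀ hf
    rw [hs, measureReal_def, measureReal_def,
      ← Measure.map_apply_of_aemeasurable hY.aemeasurable measurableSet_Iic, hY.map_eq]
  rw [e]
  exact h

/-- **THE SAMPLE-QUANTILE CLT FOR A DOEBLIN CHAIN, in distribution, from any start.**  `π`
invariant for `κ`, `κ(x, ·) ≥ ε π` (`ε > 0`); `O` measurable, `F_π(q) = u ∈ (0,1)`, `F_π′(q) = f > 0`;
`σ_q² > 0` the Green–Kubo variance of `1{O ≤ q}`, `Y ∼ N(0, σ_q²)`.  Then for every initial law,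
with `q̂_N` the empirical `u`-quantile of `O` over the first `N` states, `√N (q̂_N − q) ⇒ Y/f`
(law `N(0, σ_q²/f²)`). [ours] -/
theorem chain_sampleQuantile_clt (hπ : Kernel.Invariant κ π) {ε : ℝ≥0∞}
    (hmin : ∀ x {B : Set Ω}, MeasurableSet B → ε * π B ≤ κ x B) (hε0 : 0 < ε)
    {O : Ω → ℝ} (hO : Measurable O) {u q f : ℝ} (hu0 : 0 < u) (hu1 : u < 1)
    (hFq : cdf (π.map O) q = u) (hder : HasDerivAt (cdf (π.map O)) f q) (hf : 0 < f)
    (hσ : 0 < (∫ y, ((Set.Iic q).indicator (1 : ℝ → ℝ) (O y)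
        - ∫ z, (Set.Iic q).indicator (1 : ℝ → ℝ) (O z) ∂π) ^ 2 ∂π)
      + 2 * ∑' k, ∫ y, ((Set.Iic q).indicator (1 : ℝ → ℝ) (O y)
        - ∫ z, (Set.Iic q).indicator (1 : ℝ → ℝ) (O z) ∂π)
        * (kop κ)^[k + 1] (fun y => (Set.Iic q).indicator (1 : ℝ → ℝ) (O y)
          - ∫ z, (Set.Iic q).indicator (1 : ℝ → ℝ) (O z) ∂π) y ∂π)
    (hY : HasLaw Y (gaussianReal 0 (Real.toNNReal ((∫ y, ((Set.Iic q).indicator (1 : ℝ → ℝ) (O y)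
        - ∫ z, (Set.Iic q).indicator (1 : ℝ → ℝ) (O z) ∂π) ^ 2 ∂π)
      + 2 * ∑' k, ∫ y, ((Set.Iic q).indicator (1 : ℝ → ℝ) (O y)
        - ∫ z, (Set.Iic q).indicator (1 : ℝ → ℝ) (O z) ∂π)
        * (kop κ)^[k + 1] (fun y => (Set.Iic q).indicator (1 : ℝ → ℝ) (O y)
          - ∫ z, (Set.Iic q).indicator (1 : ℝ → ℝ) (O z) ∂π) y ∂π))) P')
    [IsProbabilityMeasure (Kernel.trajMeasure (X := fun _ : ℕ => Ω) μ₀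
          (fun m : ℕ => κ.comap (fun y : (i : ↥(Finset.Iic m)) → Ω => y ⟨m, Finset.mem_Iic.2 le_rfl⟩)
            (measurable_pi_apply _)))] :
    TendstoInDistribution (fun (N : ℕ) (ξ : ℕ → Ω) =>
        Real.sqrt N * (sInf {y | u ≤
            (∑ i ∈ range N, (Set.Iic y).indicator (1 : ℝ → ℝ) (O (ξ i))) / N} - q))
      atTop (fun ω => Y ω / f) (fun _ => Kernel.trajMeasure (X := fun _ : ℕ => Ω) μ₀
          (fun m : ℕ => κ.comap (fun y : (i : ↥(Finset.Iic m)) → Ω => y ⟨m, Finset.mem_Iic.2 le_rfl⟩)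
            (measurable_pi_apply _))) P' := by
  -- halve the minorisation constant to meet `ε < 1` in row 8's CLT
  obtain ⟨hε2, -, -, -, -, -⟩ := half_const_bounds hmin hε0
  have hmin2 : ∀ x {B : Set Ω}, MeasurableSet B → ε / 2 * π B ≤ κ x B := fun x B hB =>
    (hmin x hB).trans' (by gcongr; exact ENNReal.half_le_self)
  have hε20 : 0 < ε / 2 := ENNReal.half_pos hε0.ne'
  obtain ⟨hgm, hgb, -⟩ := integrable_indicator_Iic_comp π hO q
  have hclt := markovChain_clt (κ := κ) (ν := π) (ε := ε / 2) hπ hmin2 hε20 hε2 hgm hgb μ₀ hY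
  rw [integral_indicator_Iic_comp π hO, hFq] at hclt
  have hv : Real.toNNReal ((∫ y, ((Set.Iic q).indicator (1 : ℝ → ℝ) (O y)
        - ∫ z, (Set.Iic q).indicator (1 : ℝ → ℝ) (O z) ∂π) ^ 2 ∂π)
      + 2 * ∑' k, ∫ y, ((Set.Iic q).indicator (1 : ℝ → ℝ) (O y)
        - ∫ z, (Set.Iic q).indicator (1 : ℝ → ℝ) (O z) ∂π)
        * (kop κ)^[k + 1] (fun y => (Set.Iic q).indicator (1 : ℝ → ℝ) (O y)
          - ∫ z, (Set.Iic q).indicator (1 : ℝ → ℝ) (O z) ∂π) y ∂π) ≠ 0 := by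
    rw [Ne, Real.toNNReal_eq_zero, not_le]
    exact hσ
  exact sampleQuantile_clt_of_edf_clt (μ₀ := μ₀) hπ hmin hε0 hO hu0 hu1 hFq hder hf hv hY hclt

end QuantileCLT

end Summit.Ventures.LatticeQCDFlow.Scoring.GlivenkoCantelli

end
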